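import Literature.NumberTheory.LFunctions.Zhang2022.RepairDetShiftPSDHalfFiveHalvesThree
import Literature.NumberTheory.LFunctions.Zhang2022.RepairDetShiftPSDHalfThreeHalvesTwo
import Literature.NumberTheory.LFunctions.Zhang2022.RepairDetShiftPSDHalfOneThreeHalves
import Literature.NumberTheory.LFunctions.Zhang2022.RepairDetShiftPSDHalfThreeSevenHalves
import Literature.NumberTheory.LFunctions.Zhang2022.RepairDetShiftPSDHalfFourNineHalves

/-!
# Zhang (2022) §18-margin repair rung, barrier extension (cell landau-siegel §E, rows S-E-p6-2 / S-E-p5-6):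
# the DISCHARGED SET of the E-010 slot of `Repair.familyDetShift` in one declaration

Y. Zhang, *Discrete mean estimates and the Landau–Siegel zero*, arXiv:2211.02515v1 [Zhang2022LandauSiegel] —
an unrefereed manuscript under adjudication. **WHAT THIS IS NOT: a claim about its Theorems 1–2, about
Landau–Siegel zeros, about Parity, or about a repaired `Margin232`. The programme SEARCHES and TYPES; no claim
about Landau–Siegel zeros, Theorems 1–2 of arXiv:2211.02515 or a repaired Margin232 until a kernel theorem says so.**

Bookkeeping leaf (theorems only, nothing re-proved): the §E family `Repair.familyDetShift` (`RepairDetShift`, p460173;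
row 17 of the class of record) carries the E-010 slot `Det.FormDetPSD (Det.shiftRecipe b)` DISPLAYED; the slot is a
tree theorem at the printed triple and at four sign-admissible half-integer triples, each by an exact polynomial LQ
certificate checked in the kernel (certificate format `Det.formDetPSD_of_certificate`, ls-barrier-p6, p468669):

| triple `b` | decl | file / proposal | certificate |
|---|---|---|---|
| `(1, 2, 3)` (printed) | `Det.formDetPSD_shiftRecipe_std` | DetectorMainTermForm | Prop 7.1's quarter-wave diagonalisation (`MainTermFormPSD`) |
| `b⋆ = (1/2; 2, 5/2)` | `Det.formDetPSD_shiftRecipe_bStar` | RepairDetShiftPSD, p473995 (ls-barrier-p6) | kit j260562 dyadic `K`, degree 8 |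
| `b⋆⋆ = (1/2; 5/2, 3)` | `Det.formDetPSD_shiftRecipe_bStar2` | RepairDetShiftPSDHalfFiveHalvesThree, p477435 | barrier-num CERT-shift-1_2-5_2-3 (deg 6), transported |
| `b⋆₃ = (1/2; 3/2, 2)` | `Det.formDetPSD_shiftRecipe_bStar3` | RepairDetShiftPSDHalfThreeHalvesTwo, p478284 | barrier-num CERT-shift-1_2-3_2-2 (deg 7), transported |
| `b⋆₄ = (1/2; 1, 3/2)` | `Det.formDetPSD_shiftRecipe_bStar4` | RepairDetShiftPSDHalfOneThreeHalves, p478316 | barrier-num CERT-shift-1_2-1-3_2 (deg 8), transported |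

So the row text «CONDITIONAL on E-010 off `{(1,2,3), b⋆, b⋆⋆, b⋆₃, b⋆₄}`» (barrier/BARRIER-STATE.md §2′ N6) is the
theorem `Repair.detShift_unconditional_of_discharged` below: every member of `familyDetShift` whose detector is one of the
five triples satisfies the verdict's conclusion OUTRIGHT. Lattice gaps anchored (ls-barrier-num H-CLOSED-FORM.md
f80d823e4b71f884 «one kernel anchor per gap»): `k = 1` (b⋆₃, b⋆₄), `k = 2` (b⋆, b⋆⋆); `k = 3, 4` open. Currency (C3(e)):
FormDet = formula I on ONE-SIDED kinked profiles; nothing here is a statement about zeros.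

References: Y. Zhang, arXiv:2211.02515v1 (2022), §2 (2.13), Lemma 2.3, (2.16)–(2.18), (2.32)–(2.33); §7 Prop. 7.1 [p. 44].
[cite: Zhang2022LandauSiegel, §2 Lemma 2.3; §7 Prop. 7.1]
-/

noncomputable section

open Complex Real

namespace Literature.NumberTheory.LFunctions.Zhang2022

namespace Det

open Repair

/-- **The discharged set, as one conjunction**: the E-010 slot `FormDetPSD (shiftRecipe b)` holds at the five triples
`(1,2,3)`, `b⋆ = (1/2;2,5/2)`, `b⋆⋆ = (1/2;5/2,3)`, `b⋆₃ = (1/2;3/2,2)`, `b⋆₄ = (1/2;1,3/2)`.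
[cite: Zhang2022LandauSiegel, §7 Prop. 7.1 p.44; §2 Lemma 2.3] -/
theorem formDetPSD_shiftRecipe_discharged5 :
    FormDetPSD (shiftRecipe ![1, 2, 3]) ∧ FormDetPSD (shiftRecipe bStar) ∧ FormDetPSD (shiftRecipe bStar2) ∧
      FormDetPSD (shiftRecipe bStar3) ∧ FormDetPSD (shiftRecipe bStar4) :=
  ⟨formDetPSD_shiftRecipe_std, formDetPSD_shiftRecipe_bStar, formDetPSD_shiftRecipe_bStar2,
    formDetPSD_shiftRecipe_bStar3, formDetPSD_shiftRecipe_bStar4⟩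

/-- The slot at any member of the discharged set (membership as a disjunction of equalities, so that the lemma is
usable by `rcases`/`subst` on a concrete design). [cite: Zhang2022LandauSiegel, §7 Prop. 7.1 p.44; §2 Lemma 2.3] -/
theorem formDetPSD_shiftRecipe_of_discharged {b : Fin 3 → ℝ}
    (hb : b = ![1, 2, 3] ∨ b = bStar ∨ b = bStar2 ∨ b = bStar3 ∨ b = bStar4) :
    FormDetPSD (shiftRecipe b) := by
  rcases hb with rfl | rfl | rfl | rfl | rfl
  · exact formDetPSD_shiftRecipe_std
  · exact formDetPSD_shiftRecipe_bStar
  · exact formDetPSD_shiftRecipe_bStar2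
  · exact formDetPSD_shiftRecipe_bStar3
  · exact formDetPSD_shiftRecipe_bStar4

/-- The five triples are pairwise distinct detectors (so the discharged set has five points, four off print; the
second shift `b 1 ∈ {2, 5/2, 3/2, 1}` already separates the four half-integer triples).
[cite: Zhang2022LandauSiegel, §2 (2.13)] -/
theorem discharged_triples_ne :
    bStar ≠ ![1, 2, 3] ∧ bStar2 ≠ ![1, 2, 3] ∧ bStar3 ≠ ![1, 2, 3] ∧ bStar4 ≠ ![1, 2, 3] ∧
      bStar2 ≠ bStar ∧ bStar3 ≠ bStar ∧ bStar4 ≠ bStar ∧ bStar3 ≠ bStar2 ∧ bStar4 ≠ bStar2 ∧ bStar4 ≠ bStar3 := by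
  refine ⟨bStar_ne_std, bStar2_ne_std, bStar3_ne_std, bStar4_ne_std, ?_, ?_, ?_, ?_, ?_, ?_⟩ <;>
  · intro h
    have h1 := congr_fun h 1
    norm_num [bStar, bStar2, bStar3, bStar4] at h1

end Det

namespace Repair

open Det

/-- **Row 17 of the class of record, read with its discharged set**: every member of `familyDetShift` whose
detector `b` is one of the five triples `(1,2,3)`, `b⋆`, `b⋆⋆`, `b⋆₃`, `b⋆₄` satisfies the verdict's conclusion
OUTRIGHT — no displayed slot: `¬ (𝔅_b(u)·𝔅_b(f) < ‖P_b(u,f)‖²)` for its one-sided kinked legs. Off these five points the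
row stays CONDITIONAL on E-010 (BARRIER-STATE §2′ N6). [cite: Zhang2022LandauSiegel, §2 (2.18), (2.32)–(2.33); §7 Prop. 7.1 p.44] -/
theorem detShift_unconditional_of_discharged (d : DetShiftDesign) (h : d.InClass)
    (hb : d.b = ![1, 2, 3] ∨ d.b = bStar ∨ d.b = bStar2 ∨ d.b = bStar3 ∨ d.b = bStar4) :
    ¬ (FormDet (shiftRecipe d.b) d.u d.u' * FormDet (shiftRecipe d.b) d.f d.f'
        < ‖FormDetPolar (shiftRecipe d.b) d.u d.u' d.f d.f'‖ ^ 2) :=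
  not_repairable_detShift d h (formDetPSD_shiftRecipe_of_discharged hb)

/-- Hence the family's VERDICT (slot-displayed implication) holds with the slot discharged, at those five detectors:
for such members `familyDetShift.Verdict d` is not merely «slot → conclusion» but the conclusion itself.
[cite: Zhang2022LandauSiegel, §2 (2.18), (2.32)–(2.33)] -/
theorem familyDetShift_verdict_and_slot_of_discharged (d : DetShiftDesign) (h : d.InClass)
    (hb : d.b = ![1, 2, 3] ∨ d.b = bStar ∨ d.b = bStar2 ∨ d.b = bStar3 ∨ d.b = bStar4) :
    familyDetShift.Verdict d ∧ FormDetPSD (shiftRecipe d.b) :=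
  ⟨familyDetShift_decided d h, formDetPSD_shiftRecipe_of_discharged hb⟩

end Repair


/-! ### Part 2 (2026-08-27T01:2xZ): the k = 3 anchor `b⋆₅ = (1/2; 3, 7/2)` joins the discharged set

`Det.formDetPSD_shiftRecipe_bStar5` (RepairDetShiftPSDHalfThreeSevenHalves, p481000; certificate = ls-barrier-num's
DOMINANCE-format certificate CERT-dom-HalfThreeSevenHalves.json 3d988c98fa176063 / FACT-C p479652, transported) makes SIX
triples; lattice gaps `k = 1, 2, 3` are anchored (H-CLOSED-FORM «one kernel anchor per gap»); `k = 4` = `(1/2; 4, 9/2)` is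
ls-barrier-p4's row S-E-p4-8 and joins in Part 3. Append-only; Part 1 above unchanged. -/

namespace Det

open Repair

/-- **The discharged set with the `k = 3` anchor, as one conjunction** (six triples).
[cite: Zhang2022LandauSiegel, §7 Prop. 7.1 p.44; §2 Lemma 2.3] -/
theorem formDetPSD_shiftRecipe_discharged6 :
    FormDetPSD (shiftRecipe ![1, 2, 3]) ∧ FormDetPSD (shiftRecipe bStar) ∧ FormDetPSD (shiftRecipe bStar2) ∧
      FormDetPSD (shiftRecipe bStar3) ∧ FormDetPSD (shiftRecipe bStar4) ∧ FormDetPSD (shiftRecipe bStar5) :=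
  ⟨formDetPSD_shiftRecipe_std, formDetPSD_shiftRecipe_bStar, formDetPSD_shiftRecipe_bStar2,
    formDetPSD_shiftRecipe_bStar3, formDetPSD_shiftRecipe_bStar4, formDetPSD_shiftRecipe_bStar5⟩

/-- The slot at any member of the six-point discharged set. [cite: Zhang2022LandauSiegel, §7 Prop. 7.1 p.44; §2 Lemma 2.3] -/
theorem formDetPSD_shiftRecipe_of_discharged6 {b : Fin 3 → ℝ}
    (hb : b = ![1, 2, 3] ∨ b = bStar ∨ b = bStar2 ∨ b = bStar3 ∨ b = bStar4 ∨ b = bStar5) :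
    FormDetPSD (shiftRecipe b) := by
  rcases hb with rfl | rfl | rfl | rfl | rfl | rfl
  · exact formDetPSD_shiftRecipe_std
  · exact formDetPSD_shiftRecipe_bStar
  · exact formDetPSD_shiftRecipe_bStar2
  · exact formDetPSD_shiftRecipe_bStar3
  · exact formDetPSD_shiftRecipe_bStar4
  · exact formDetPSD_shiftRecipe_bStar5

/-- `b⋆₅` is a new point of the set (second shift `3 ∉ {2, 5/2, 3/2, 1}`; not the printed triple).
[cite: Zhang2022LandauSiegel, §2 (2.13)] -/
theorem bStar5_ne_discharged5 :
    bStar5 ≠ ![1, 2, 3] ∧ bStar5 ≠ bStar ∧ bStar5 ≠ bStar2 ∧ bStar5 ≠ bStar3 ∧ bStar5 ≠ bStar4 := by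
  refine ⟨bStar5_ne_std, ?_, ?_, ?_, ?_⟩ <;>
  · intro h
    have h1 := congr_fun h 1
    norm_num [bStar, bStar2, bStar3, bStar4, bStar5] at h1

end Det

namespace Repair

open Det

/-- **Row 17 read with the six-point discharged set** (N6 after the `k = 3` anchor): every member of `familyDetShift`
whose detector is one of `(1,2,3)`, `b⋆`, `b⋆⋆`, `b⋆₃`, `b⋆₄`, `b⋆₅` satisfies the verdict's conclusion OUTRIGHT.
[cite: Zhang2022LandauSiegel, §2 (2.18), (2.32)–(2.33); §7 Prop. 7.1 p.44] -/
theorem detShift_unconditional_of_discharged6 (d : DetShiftDesign) (h : d.InClass)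
    (hb : d.b = ![1, 2, 3] ∨ d.b = bStar ∨ d.b = bStar2 ∨ d.b = bStar3 ∨ d.b = bStar4 ∨ d.b = bStar5) :
    ¬ (FormDet (shiftRecipe d.b) d.u d.u' * FormDet (shiftRecipe d.b) d.f d.f'
        < ‖FormDetPolar (shiftRecipe d.b) d.u d.u' d.f d.f'‖ ^ 2) :=
  not_repairable_detShift d h (formDetPSD_shiftRecipe_of_discharged6 hb)

end Repair


/-! ### Part 3 (2026-08-27T01:45Z): the ANCHOR TABLE by lattice gap (row S-E-p5-11, ls-barrier-plan g1 01:30:58Z)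

| gap `k` (`k ≤ b₁ < b₂ ≤ k+1`, `b₀ ≤ 1`) | kernel anchors (`FormDetPSD (shiftRecipe b)` a tree theorem) | certificate |
|---|---|---|
| `k = 0` | NONE in the kernel. No sign-admissible `k = 0` triple has recipe data in `ℚ(i)` (the phases `e^{iπ(Σb − 2b_j)/2}` are Gaussian-rational iff `b_i − b_j ∈ ½ℤ`, forcing `b₂ ≥ b₀ + 1 > 1`); an insurance candidate over `ℚ(√3, i)` is `(1/3; 2/3, 1)` (ls-num-1: `c₀ = det C = 3/4`), NOT NEEDED under the DOUBLING route (ls-barrier-num 2026-08-27T01:40:20Z: PSD on the whole sign-admissible set from `c₀ > 0` p478269 + lattice symbol `≥ 0` + the doubling identity + Parseval — no anchor in any gap) | — |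
| `k = 1` | `b⋆₃ = (1/2; 3/2, 2)` `Det.formDetPSD_shiftRecipe_bStar3` (p478284), `b⋆₄ = (1/2; 1, 3/2)` `…_bStar4` (p478316) | barrier-num CERT-shift jsons, transported (p477497 / p477794) |
| `k = 2` | `(1,2,3)` `…_std` (printed; corner), `b⋆ = (1/2; 2, 5/2)` `…_bStar` (ls-barrier-p6, p473995), `b⋆⋆ = (1/2; 5/2, 3)` `…_bStar2` (p477435) | `MainTermFormPSD`; kit j260562; CERT-shift transported (p476436) |
| `k = 3` | `b⋆₅ = (1/2; 3, 7/2)` `…_bStar5` (p481000) | barrier-num DOMINANCE FACT-C p479652 (p480561) |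
| `k = 4` | `(1/2; 4, 9/2)` = ls-barrier-p4's row S-E-p4-8 (in flight) | barrier-num FACT-C p479602 / CERT-shift deg 16 |

One declaration carrying the table's kernel content: for each landed anchor, its SIGN-ADMISSIBILITY, its GAP, and the slot.
Append-only; Parts 1–2 above unchanged. -/

namespace Repair

open Det

/-- **The anchor table of the E-010 slot by lattice gap (gaps `k = 1, 2, 3`)**: each listed triple is sign-admissible,
lies in the stated gap (`k ≤ b 1 ∧ b 2 ≤ k + 1`), and carries the slot `FormDetPSD (shiftRecipe b)` as a tree theorem.
Gap `0`: no kernel anchor (none exists over `ℚ(i)`; not needed under the doubling route); gap `4`: ls-barrier-p4's row.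
[cite: Zhang2022LandauSiegel, §2 (2.13), Lemma 2.3; §7 Prop. 7.1 p.44] -/
theorem detShift_anchor_table :
    -- gap 1
    ((SignAdmissible bStar3 ∧ ((1 : ℝ) ≤ bStar3 1 ∧ bStar3 2 ≤ 1 + 1) ∧ FormDetPSD (shiftRecipe bStar3)) ∧
      (SignAdmissible bStar4 ∧ ((1 : ℝ) ≤ bStar4 1 ∧ bStar4 2 ≤ 1 + 1) ∧ FormDetPSD (shiftRecipe bStar4))) ∧
    -- gap 2
    ((SignAdmissible ![1, 2, 3] ∧ ((2 : ℝ) ≤ (![1, 2, 3] : Fin 3 → ℝ) 1 ∧ (![1, 2, 3] : Fin 3 → ℝ) 2 ≤ 2 + 1) ∧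
        FormDetPSD (shiftRecipe ![1, 2, 3])) ∧
      (SignAdmissible bStar ∧ ((2 : ℝ) ≤ bStar 1 ∧ bStar 2 ≤ 2 + 1) ∧ FormDetPSD (shiftRecipe bStar)) ∧
      (SignAdmissible bStar2 ∧ ((2 : ℝ) ≤ bStar2 1 ∧ bStar2 2 ≤ 2 + 1) ∧ FormDetPSD (shiftRecipe bStar2))) ∧
    -- gap 3
    (SignAdmissible bStar5 ∧ ((3 : ℝ) ≤ bStar5 1 ∧ bStar5 2 ≤ 3 + 1) ∧ FormDetPSD (shiftRecipe bStar5)) := by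
  refine ⟨⟨⟨signAdmissible_bStar3.1, ?_, formDetPSD_shiftRecipe_bStar3⟩,
      ⟨signAdmissible_bStar4.1, ?_, formDetPSD_shiftRecipe_bStar4⟩⟩,
    ⟨⟨signAdmissible_std, ?_, formDetPSD_shiftRecipe_std⟩, ⟨signAdmissible_bStar.1, ?_, formDetPSD_shiftRecipe_bStar⟩,
      ⟨signAdmissible_bStar2.1, ?_, formDetPSD_shiftRecipe_bStar2⟩⟩,
    ⟨signAdmissible_bStar5.1, ?_, formDetPSD_shiftRecipe_bStar5⟩⟩ <;>
    norm_num [bStar, bStar2, bStar3, bStar4, bStar5, Matrix.cons_val_two, Matrix.tail_cons, Matrix.head_cons]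

end Repair


/-! ### Part 4 (2026-08-27T02:4xZ, ls-barrier-p4 g3): the k = 4 anchor `b♯₄ = (1/2; 4, 9/2)` joins — SEVEN triples,
every lattice gap `k = 1, 2, 3, 4` of the Part-III box is kernel-anchored

`Det.formDetPSD_shiftRecipe_bGap4` (RepairDetShiftPSDHalfFourNineHalves, p487128; data RepairDetShiftPSDCertHalfFourNineHalves
p486862 = ls-barrier-num's degree-16 certificate CERT-shift-1_2-4-9_2.json 6f03d50e609d33a4 transported, positivity by the
exact-rational sign cells of `Literature/Analysis/ValidatedNumerics/PolySignCells.lean` p486367, `decide +kernel`) makes SEVEN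
triples. Under the cell's DOUBLING plan of record (ls-barrier-plan g1 2026-08-27T01:45:23Z) anchors are INSURANCE, not
prerequisites; `k = 0` has no `ℚ(i)` anchor (Part 3). Append-only; Parts 1–3 unchanged. -/

namespace Det

open Repair

/-- **The discharged set with the `k = 4` anchor, as one conjunction** (seven triples).
[cite: Zhang2022LandauSiegel, §7 Prop. 7.1 p.44; §2 Lemma 2.3] -/
theorem formDetPSD_shiftRecipe_discharged7 :
    FormDetPSD (shiftRecipe ![1, 2, 3]) ∧ FormDetPSD (shiftRecipe bStar) ∧ FormDetPSD (shiftRecipe bStar2) ∧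
      FormDetPSD (shiftRecipe bStar3) ∧ FormDetPSD (shiftRecipe bStar4) ∧ FormDetPSD (shiftRecipe bStar5) ∧
      FormDetPSD (shiftRecipe bGap4) :=
  ⟨formDetPSD_shiftRecipe_std, formDetPSD_shiftRecipe_bStar, formDetPSD_shiftRecipe_bStar2,
    formDetPSD_shiftRecipe_bStar3, formDetPSD_shiftRecipe_bStar4, formDetPSD_shiftRecipe_bStar5,
    formDetPSD_shiftRecipe_bGap4⟩

/-- The slot at any member of the seven-point discharged set. [cite: Zhang2022LandauSiegel, §7 Prop. 7.1 p.44; §2 Lemma 2.3] -/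
theorem formDetPSD_shiftRecipe_of_discharged7 {b : Fin 3 → ℝ}
    (hb : b = ![1, 2, 3] ∨ b = bStar ∨ b = bStar2 ∨ b = bStar3 ∨ b = bStar4 ∨ b = bStar5 ∨ b = bGap4) :
    FormDetPSD (shiftRecipe b) := by
  rcases hb with rfl | rfl | rfl | rfl | rfl | rfl | rfl
  · exact formDetPSD_shiftRecipe_std
  · exact formDetPSD_shiftRecipe_bStar
  · exact formDetPSD_shiftRecipe_bStar2
  · exact formDetPSD_shiftRecipe_bStar3
  · exact formDetPSD_shiftRecipe_bStar4
  · exact formDetPSD_shiftRecipe_bStar5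
  · exact formDetPSD_shiftRecipe_bGap4

/-- `b♯₄` is a new point of the set (second shift `4 ∉ {2, 5/2, 3/2, 1, 3}`; not the printed triple).
[cite: Zhang2022LandauSiegel, §2 (2.13)] -/
theorem bGap4_ne_discharged6 :
    bGap4 ≠ ![1, 2, 3] ∧ bGap4 ≠ bStar ∧ bGap4 ≠ bStar2 ∧ bGap4 ≠ bStar3 ∧ bGap4 ≠ bStar4 ∧ bGap4 ≠ bStar5 := by
  refine ⟨bGap4_ne_std, ?_, ?_, ?_, ?_, ?_⟩ <;>
  · intro h
    have h1 := congr_fun h 1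
    norm_num [bStar, bStar2, bStar3, bStar4, bStar5, bGap4] at h1

/-- **Anchor table, gap 4 row** (complements `detShift_anchor_table`): `b♯₄` is sign-admissible, lies in the lattice gap
`4 ≤ b₂`, `b₃ ≤ 5`, and the slot holds there. [cite: Zhang2022LandauSiegel, §2 (2.13), Lemma 2.3; §7 Prop. 7.1 p.44] -/
theorem detShift_anchor_gap4 :
    SignAdmissible bGap4 ∧ ((4 : ℝ) ≤ bGap4 1 ∧ bGap4 2 ≤ 4 + 1) ∧ FormDetPSD (shiftRecipe bGap4) := by
  refine ⟨signAdmissible_bGap4.1, ?_, formDetPSD_shiftRecipe_bGap4⟩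
  norm_num [bGap4, Matrix.cons_val_two, Matrix.tail_cons, Matrix.head_cons]

end Det

namespace Repair

open Det

/-- **Row 17 read with the seven-point discharged set** (N6 after the `k = 4` anchor): every member of `familyDetShift`
whose detector is one of `(1,2,3)`, `b⋆`, `b⋆⋆`, `b⋆₃`, `b⋆₄`, `b⋆₅`, `b♯₄` satisfies the verdict's conclusion OUTRIGHT.
[cite: Zhang2022LandauSiegel, §2 (2.18), (2.32)–(2.33); §7 Prop. 7.1 p.44] -/
theorem detShift_unconditional_of_discharged7 (d : DetShiftDesign) (h : d.InClass)
    (hb : d.b = ![1, 2, 3] ∨ d.b = bStar ∨ d.b = bStar2 ∨ d.b = bStar3 ∨ d.b = bStar4 ∨ d.b = bStar5 ∨ d.b = bGap4) :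
    ¬ (FormDet (shiftRecipe d.b) d.u d.u' * FormDet (shiftRecipe d.b) d.f d.f'
        < ‖FormDetPolar (shiftRecipe d.b) d.u d.u' d.f d.f'‖ ^ 2) :=
  not_repairable_detShift d h (formDetPSD_shiftRecipe_of_discharged7 hb)

end Repair

end Literature.NumberTheory.LFunctions.Zhang2022
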